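import Summits.QuantumFields.YangMills.Theorems.VirialFluxGapCentralField
import Summits.QuantumFields.YangMills.Theorems.VirialFluxGapCentralSignSelector
import Mathlib.Analysis.SpecialFunctions.Sqrt
import HarnessLib

/-!
# Route `VirialFluxGap` (YangMills): the explicit central field is SMOOTH — `contDiff_centralCoeff` for w3 g59's coefficient family `c²`
# (✓`VirialFluxGapCentralFieldDefs`), also with the smooth sign selectors substituted (ONE global smooth family)

Toward ⟨stmt-QuantumFields-24141⟩ `VirialFluxGap.PeriodicSoftness`.  The last-mile reduction ✓`periodicSoftness_of_smoothFrameField_cutoff` and the patching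
calculus ✓`FieldPatching` (w2 g52) want the coefficient families as `C^∞` functions of the ambient coordinates.  w3 g59's `centralCoeff L σ σ₄ va M`
(`= fixCoord (centralDir L σ σ₄ M) va`, the explicit field `X_z + U` anchored at the CLAMPED central lift) is built from: real-linear readings of matrix entries
(`readQuat`, `blockAvgM`, `seamAvgM`), the clamped radius `σ√(1 − |z|²ψ(|z|²))` (`clampRe`; `ψ` = ✓`deficitStep`), quaternion products (`anchoredIm`) and the
half-Pauli coordinates (✓`pauliCoord`).  This file (w2 g52, at w3 g59's request 02:07Z) proves the smoothness with NO support condition: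

* §1 atoms: `contDiff_entry_re ∕ _im`, `contDiff_readQuat_*_fst ∕ _snd` (the four real components of `readQuat` of a coordinate), `contDiff_blockAvgM`,
  `contDiff_seamAvgM`; ★ `mul_deficitStep_lt_one` (`t·ψ(t) < 1` for ALL real `t`; cf. w3's ✓`clamp_radicand_pos`), `contDiff_clampRadius`, ★ `contDiff_clampRe_comp`
  (`M ↦ clampRe (s M) (z M)` is smooth for smooth `s`, `z` — `Real.sqrt` is only ever evaluated on `(0, ∞)`);
* §2 `anchoredIm_apply_zero ∕ _one ∕ _two` (the three components of `Im(c̄·readQuat X)` as polynomials), ★ `contDiff_anchoredIm_comp`;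
  `pauliCoord_quatMatrix` (`pauliCoord (quatMatrix q) = (2q_K, 2q_J, 2q_I)`; `pauliCoord 0 = 0` is ✓`FixFrame.pauliCoord_zero`);
* §3 ★★ `contDiff_centralDir_pauliCoord` — every half-Pauli coordinate of every slot of `centralDir L (s M) (s₄ M) M` is smooth in `M` for smooth sign
  functions `s`, `s₄` (the branch conditions of `centralDir` do not depend on `M`);
* §4 ★★★ `contDiff_centralCoeff_param` (smooth `s`, `s₄`), ★★★ `contDiff_centralCoeff` (constant signs — hypothesis `hc` of the last mile for the central piece),
  ★★★ `contDiff_centralCoeff_sign` (`σ_k := linkSign k M`, `σ₄ := seamSign M`, ✓`CentralSignSelector`: the ONE global smooth central family).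

HONEST FRAMING: regularity plumbing (theorems only, 0 `def`, 0 `sorry`, standard axioms); the identification with `X_z + U`, the drive, the divergence and the
assembly are NOT here; ⟨24141⟩ and ⟨22884⟩ stay OPEN; no stub ∕ crux ∕ rung ∕ summit is closed; the Yang–Mills mass gap is NOT proved; no summit is proved by a
line.  Width seat `ym-line-sfw-p2-w2` g52 (cell ym-idea-1, free hands), `--supports stmt-QuantumFields-24141`.  References: [cite: CosteEtAl1985]; [folklore].
-/

set_option autoImplicit false

noncomputable section

open scoped Matrix BigOperators ContDiff Topology Quaternion
open MeasureTheory
open Literature.MathematicalPhysics.QuantumFieldTheory hiding SU2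
open Literature.MathematicalPhysics.QuantumLattice
open Literature.MathematicalPhysics.QuantumFieldTheory.SUNBakryEmery (expSU coe_expSU matTop)

namespace Summit.QuantumFields.YangMills.Theorems.VirialFluxGap.CentralField

open Summit.QuantumFields.YangMills.Theorems.FemtoTransferGap
open Summit.QuantumFields.YangMills.Theorems.FemtoTransferGap.TT
open Summit.QuantumFields.YangMills.Theorems.VirialFluxGap.RingDeficit
open Summit.QuantumFields.YangMills.Theorems.VirialFluxGap.FrameDerivative
open Summit.QuantumFields.YangMills.Theorems.VirialFluxGap.FrameHessian
open Summit.QuantumFields.YangMills.Theorems.VirialFluxGap.FixFrame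
open Summit.QuantumFields.YangMills.Theorems.VirialFluxGap.RegCutoff

variable {L : ℕ} [NeZero L]

open scoped Matrix.Norms.Frobenius

attribute [local instance 2000] Literature.MathematicalPhysics.QuantumFieldTheory.SUNBakryEmery.matTop

/-! ## §1 Atoms: matrix entries, block averages, the clamped radius -/

omit [NeZero L] in
/-- The real part of a matrix entry is smooth (real-linear). [folklore] -/
theorem contDiff_entry_re (i j : Fin 2) : ContDiff ℝ ∞ fun X : Matrix (Fin 2) (Fin 2) ℂ => (X i j).re :=
  (LinearMap.toContinuousLinearMap
    ({ toFun := fun X : Matrix (Fin 2) (Fin 2) ℂ => (X i j).re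
       map_add' := fun X Y => by simp
       map_smul' := fun c X => by simp } : Matrix (Fin 2) (Fin 2) ℂ →ₗ[ℝ] ℝ)).contDiff

omit [NeZero L] in
/-- The imaginary part of a matrix entry is smooth (real-linear). [folklore] -/
theorem contDiff_entry_im (i j : Fin 2) : ContDiff ℝ ∞ fun X : Matrix (Fin 2) (Fin 2) ℂ => (X i j).im :=
  (LinearMap.toContinuousLinearMap
    ({ toFun := fun X : Matrix (Fin 2) (Fin 2) ℂ => (X i j).im
       map_add' := fun X Y => by simp
       map_smul' := fun c X => by simp } : Matrix (Fin 2) (Fin 2) ℂ →ₗ[ℝ] ℝ)).contDiff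

omit [NeZero L] in
/-- The four components of `readQuat` are smooth functions of the matrix. [folklore] -/
theorem contDiff_readQuat_components :
    (ContDiff ℝ ∞ fun X : Matrix (Fin 2) (Fin 2) ℂ => (readQuat X).re) ∧ (ContDiff ℝ ∞ fun X : Matrix (Fin 2) (Fin 2) ℂ => (readQuat X).imI) ∧
    (ContDiff ℝ ∞ fun X : Matrix (Fin 2) (Fin 2) ℂ => (readQuat X).imJ) ∧ (ContDiff ℝ ∞ fun X : Matrix (Fin 2) (Fin 2) ℂ => (readQuat X).imK) :=
  ⟨contDiff_entry_re 0 0, contDiff_entry_im 0 0, contDiff_entry_re 0 1, contDiff_entry_im 0 1⟩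

omit [NeZero L] in
/-- The components of `imVec (readQuat X)` are smooth. [folklore] -/
theorem contDiff_imVec_readQuat (a : Fin 3) : ContDiff ℝ ∞ fun X : Matrix (Fin 2) (Fin 2) ℂ => imVec (readQuat X) a := by
  obtain ⟨_, h1, h2, h3⟩ := contDiff_readQuat_components
  fin_cases a
  · simpa [imVec] using h1
  · simpa [imVec] using h2
  · simpa [imVec] using h3

/-- ★ The wrap-block averages are smooth functions of the coordinates (finite sums of linear readings). [folklore] -/
theorem contDiff_blockAvgM (k a : Fin 3) :
    ContDiff ℝ ∞ fun M : (Fin (2 * L - 1 + 1) → Edge 3 L → Matrix (Fin 2) (Fin 2) ℂ) × (Site 3 L → Matrix (Fin 2) (Fin 2) ℂ) => blockAvgM L k M a := by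
  unfold blockAvgM
  refine ContDiff.div_const ?_ _
  refine ContDiff.sum fun v _ => ?_
  exact (contDiff_imVec_readQuat a).comp (contDiff_coord_fst v.1 (v.2, k))

/-- ★ The seam average is a smooth function of the coordinates. [folklore] -/
theorem contDiff_seamAvgM (a : Fin 3) :
    ContDiff ℝ ∞ fun M : (Fin (2 * L - 1 + 1) → Edge 3 L → Matrix (Fin 2) (Fin 2) ℂ) × (Site 3 L → Matrix (Fin 2) (Fin 2) ℂ) => seamAvgM L M a := by
  unfold seamAvgM
  refine ContDiff.div_const ?_ _
  refine ContDiff.sum fun x _ => ?_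
  exact (contDiff_imVec_readQuat a).comp (contDiff_coord_snd x)

omit [NeZero L] in
/-- ★ `t·ψ(t) < 1` for EVERY real `t` (`t ≤ ½`: `≤ ½`; `½ < t < 1`: `≤ t`; `t ≥ 1`: `ψ = 0`; `t < 0`: `≤ 0`). [folklore] -/
theorem mul_deficitStep_lt_one (t : ℝ) : t * deficitStep t < 1 := by
  have h0 := deficitStep_nonneg t
  have h1 := deficitStep_le_one t
  by_cases ht : t < 1
  · by_cases ht0 : 0 ≤ t
    · calc t * deficitStep t ≤ t * 1 := mul_le_mul_of_nonneg_left h1 ht0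
        _ < 1 := by linarith
    · push Not at ht0
      calc t * deficitStep t ≤ 0 := mul_nonpos_of_nonpos_of_nonneg ht0.le h0
        _ < 1 := one_pos
  · push Not at ht
    rw [deficitStep_eq_zero ht, mul_zero]
    exact one_pos

omit [NeZero L] in
/-- The clamped radius `t ↦ √(1 − tψ(t))` is smooth on all of `ℝ` (`Real.sqrt` off `0`). [folklore] -/
theorem contDiff_clampRadius : ContDiff ℝ ∞ fun t : ℝ => Real.sqrt (1 - t * deficitStep t) :=
  (contDiff_const.sub (contDiff_id.mul contDiff_deficitStep)).sqrt fun t => (clamp_radicand_pos t).ne'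

omit [NeZero L] in
/-- ★ **The clamped real part is smooth in all its arguments**: for smooth `s : E → ℝ` and smooth components `z₀ z₁ z₂ : E → ℝ`,
`x ↦ clampRe (s x) (z x)` is smooth. [folklore] -/
theorem contDiff_clampRe_comp {E : Type*} [NormedAddCommGroup E] [NormedSpace ℝ E] {s : E → ℝ} {z : E → Fin 3 → ℝ} (hs : ContDiff ℝ ∞ s)
    (hz : ∀ a, ContDiff ℝ ∞ fun x => z x a) : ContDiff ℝ ∞ fun x => clampRe (s x) (z x) := by
  unfold clampRe
  have ht : ContDiff ℝ ∞ fun x => (z x 0) ^ 2 + (z x 1) ^ 2 + (z x 2) ^ 2 := (((hz 0).pow 2).add ((hz 1).pow 2)).add ((hz 2).pow 2)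
  exact hs.mul (contDiff_clampRadius.comp ht)

omit [NeZero L] in
/-- The components of the clamped lift are smooth. [folklore] -/
theorem contDiff_clampLift_components {E : Type*} [NormedAddCommGroup E] [NormedSpace ℝ E] {s : E → ℝ} {z : E → Fin 3 → ℝ} (hs : ContDiff ℝ ∞ s)
    (hz : ∀ a, ContDiff ℝ ∞ fun x => z x a) :
    (ContDiff ℝ ∞ fun x => (clampLift (s x) (z x)).re) ∧ (ContDiff ℝ ∞ fun x => (clampLift (s x) (z x)).imI) ∧
    (ContDiff ℝ ∞ fun x => (clampLift (s x) (z x)).imJ) ∧ (ContDiff ℝ ∞ fun x => (clampLift (s x) (z x)).imK) :=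
  ⟨contDiff_clampRe_comp hs hz, hz 0, hz 1, hz 2⟩

/-! ## §2 The anchored profile and the half-Pauli coordinates as polynomials -/

omit [NeZero L] in
/-- The components of the anchored profile `Im(c̄·r)`, `r = readQuat X`, as polynomials in the components. [folklore] -/
theorem anchoredIm_apply (c : ℍ) (X : Matrix (Fin 2) (Fin 2) ℂ) :
    anchoredIm c X 0 = c.re * (readQuat X).imI - c.imI * (readQuat X).re - c.imJ * (readQuat X).imK + c.imK * (readQuat X).imJ ∧
    anchoredIm c X 1 = c.re * (readQuat X).imJ + c.imI * (readQuat X).imK - c.imJ * (readQuat X).re - c.imK * (readQuat X).imI ∧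
    anchoredIm c X 2 = c.re * (readQuat X).imK - c.imI * (readQuat X).imJ + c.imJ * (readQuat X).imI - c.imK * (readQuat X).re := by
  refine ⟨?_, ?_, ?_⟩ <;>
  · simp only [anchoredIm, imVec, Matrix.cons_val_zero, Matrix.cons_val_one, Matrix.cons_val, Quaternion.imI_mul, Quaternion.imJ_mul,
      Quaternion.imK_mul, Quaternion.re_star, Quaternion.imI_star, Quaternion.imJ_star, Quaternion.imK_star]
    ring

omit [NeZero L] in
/-- ★ **The anchored profile is smooth** in (anchor components, slot): for smooth real functions `c_re, c_I, c_J, c_K` and a smooth matrix-valued `X`,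
every component of `x ↦ anchoredIm (c x) (X x)` is smooth. [folklore] -/
theorem contDiff_anchoredIm_comp {E : Type*} [NormedAddCommGroup E] [NormedSpace ℝ E] {c : E → ℍ} {X : E → Matrix (Fin 2) (Fin 2) ℂ}
    (hre : ContDiff ℝ ∞ fun x => (c x).re) (hI : ContDiff ℝ ∞ fun x => (c x).imI) (hJ : ContDiff ℝ ∞ fun x => (c x).imJ)
    (hK : ContDiff ℝ ∞ fun x => (c x).imK) (hX : ContDiff ℝ ∞ X) (a : Fin 3) : ContDiff ℝ ∞ fun x => anchoredIm (c x) (X x) a := by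
  obtain ⟨qre, qI, qJ, qK⟩ := contDiff_readQuat_components
  have rre := qre.comp hX
  have rI := qI.comp hX
  have rJ := qJ.comp hX
  have rK := qK.comp hX
  have h3 : ∀ i : Fin 3, i = 0 ∨ i = 1 ∨ i = 2 := by decide
  rcases h3 a with rfl | rfl | rfl
  · have e : (fun x => anchoredIm (c x) (X x) 0) = fun x =>
        (c x).re * (readQuat (X x)).imI - (c x).imI * (readQuat (X x)).re - (c x).imJ * (readQuat (X x)).imK + (c x).imK * (readQuat (X x)).imJ :=
      funext fun x => (anchoredIm_apply (c x) (X x)).1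
    rw [e]
    exact (((hre.mul rI).sub (hI.mul rre)).sub (hJ.mul rK)).add (hK.mul rJ)
  · have e : (fun x => anchoredIm (c x) (X x) 1) = fun x =>
        (c x).re * (readQuat (X x)).imJ + (c x).imI * (readQuat (X x)).imK - (c x).imJ * (readQuat (X x)).re - (c x).imK * (readQuat (X x)).imI :=
      funext fun x => (anchoredIm_apply (c x) (X x)).2.1
    rw [e]
    exact (((hre.mul rJ).add (hI.mul rK)).sub (hJ.mul rre)).sub (hK.mul rI)
  · have e : (fun x => anchoredIm (c x) (X x) 2) = fun x =>
        (c x).re * (readQuat (X x)).imK - (c x).imI * (readQuat (X x)).imJ + (c x).imJ * (readQuat (X x)).imI - (c x).imK * (readQuat (X x)).re :=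
      funext fun x => (anchoredIm_apply (c x) (X x)).2.2
    rw [e]
    exact (((hre.mul rK).sub (hI.mul rJ)).add (hJ.mul rI)).sub (hK.mul rre)

omit [NeZero L] in
/-- The half-Pauli coordinates of a quaternion matrix: `pauliCoord (quatMatrix q) = (2q_K, 2q_J, 2q_I)`. [folklore] -/
theorem pauliCoord_quatMatrix (q : ℍ) :
    pauliCoord (quatMatrix q) 0 = 2 * q.imK ∧ pauliCoord (quatMatrix q) 1 = 2 * q.imJ ∧ pauliCoord (quatMatrix q) 2 = 2 * q.imI := by
  refine ⟨?_, ?_, ?_⟩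
  · show 2 * (quatMatrix q 0 1).im = 2 * q.imK
    rw [quatMatrix_apply_01]
  · show 2 * (quatMatrix q 0 1).re = 2 * q.imJ
    rw [quatMatrix_apply_01]
  · show 2 * (quatMatrix q 0 0).im = 2 * q.imI
    rw [quatMatrix_apply_00]

omit [NeZero L] in
/-- ★ A quaternion-matrix-valued map with smooth imaginary components has smooth half-Pauli coordinates. [folklore] -/
theorem contDiff_pauliCoord_quatMatrix_comp {E : Type*} [NormedAddCommGroup E] [NormedSpace ℝ E] {q : E → ℍ}
    (hI : ContDiff ℝ ∞ fun x => (q x).imI) (hJ : ContDiff ℝ ∞ fun x => (q x).imJ) (hK : ContDiff ℝ ∞ fun x => (q x).imK) (a : Fin 3) :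
    ContDiff ℝ ∞ fun x => pauliCoord (quatMatrix (q x)) a := by
  have h3 : ∀ i : Fin 3, i = 0 ∨ i = 1 ∨ i = 2 := by decide
  rcases h3 a with rfl | rfl | rfl
  · have e : (fun x => pauliCoord (quatMatrix (q x)) 0) = fun x => 2 * (q x).imK := funext fun x => (pauliCoord_quatMatrix (q x)).1
    rw [e]; exact contDiff_const.mul hK
  · have e : (fun x => pauliCoord (quatMatrix (q x)) 1) = fun x => 2 * (q x).imJ := funext fun x => (pauliCoord_quatMatrix (q x)).2.1
    rw [e]; exact contDiff_const.mul hJ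
  · have e : (fun x => pauliCoord (quatMatrix (q x)) 2) = fun x => 2 * (q x).imI := funext fun x => (pauliCoord_quatMatrix (q x)).2.2
    rw [e]; exact contDiff_const.mul hI

/-! ## §3 Every half-Pauli coordinate of every slot of the central direction assignment is smooth -/

/-- The anchored-plus-zero-mode components of a block slot are smooth (smooth sign function `s`, block average `z`, slot coordinate `X`). [folklore] -/
theorem contDiff_blockComponent {s : ((Fin (2 * L - 1 + 1) → Edge 3 L → Matrix (Fin 2) (Fin 2) ℂ) × (Site 3 L → Matrix (Fin 2) (Fin 2) ℂ)) → ℝ}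
    {z : ((Fin (2 * L - 1 + 1) → Edge 3 L → Matrix (Fin 2) (Fin 2) ℂ) × (Site 3 L → Matrix (Fin 2) (Fin 2) ℂ)) → Fin 3 → ℝ}
    {X : ((Fin (2 * L - 1 + 1) → Edge 3 L → Matrix (Fin 2) (Fin 2) ℂ) × (Site 3 L → Matrix (Fin 2) (Fin 2) ℂ)) → Matrix (Fin 2) (Fin 2) ℂ}
    (hs : ContDiff ℝ ∞ s) (hz : ∀ a, ContDiff ℝ ∞ fun M => z M a) (hX : ContDiff ℝ ∞ X) (b : Fin 3) :
    ContDiff ℝ ∞ fun M => anchoredIm (clampLift (s M) (z M)) (X M) b + (1 / 2 : ℝ) * s M * z M b := by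
  obtain ⟨hre, hI, hJ, hK⟩ := contDiff_clampLift_components hs hz
  exact (contDiff_anchoredIm_comp hre hI hJ hK hX b).add ((contDiff_const.mul hs).mul (hz b))

/-- ★★ **Every half-Pauli coordinate of every slot of `centralDir L (s M) (s₄ M) M` is smooth in `M`** for smooth sign functions `s_k`, `s₄` (the branch
conditions of `centralDir` depend on the slot only). [folklore] -/
theorem contDiff_centralDir_pauliCoord
    {s : ((Fin (2 * L - 1 + 1) → Edge 3 L → Matrix (Fin 2) (Fin 2) ℂ) × (Site 3 L → Matrix (Fin 2) (Fin 2) ℂ)) → Fin 3 → ℝ}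
    {s₄ : ((Fin (2 * L - 1 + 1) → Edge 3 L → Matrix (Fin 2) (Fin 2) ℂ) × (Site 3 L → Matrix (Fin 2) (Fin 2) ℂ)) → ℝ}
    (hs : ∀ k, ContDiff ℝ ∞ fun M => s M k) (hs₄ : ContDiff ℝ ∞ s₄) (w : (Fin (2 * L - 1 + 1) × Edge 3 L) ⊕ Site 3 L) (a : Fin 3) :
    ContDiff ℝ ∞ fun M : (Fin (2 * L - 1 + 1) → Edge 3 L → Matrix (Fin 2) (Fin 2) ℂ) × (Site 3 L → Matrix (Fin 2) (Fin 2) ℂ) =>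
      pauliCoord (centralDir L (s M) (s₄ M) M w) a := by
  rcases w with ⟨i, e⟩ | x
  · by_cases h1 : i = 0 ∧ treeEdge e = true
    · have e0 : (fun M : (Fin (2 * L - 1 + 1) → Edge 3 L → Matrix (Fin 2) (Fin 2) ℂ) × (Site 3 L → Matrix (Fin 2) (Fin 2) ℂ) =>
          pauliCoord (centralDir L (s M) (s₄ M) M (Sum.inl (i, e))) a) = fun _ => 0 := by
        funext M
        simp only [centralDir, h1, and_self, if_true, pauliCoord_zero]
      rw [e0]
      exact contDiff_const
    · by_cases h2 : e.1 e.2 = -1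
      · have ef : (fun M : (Fin (2 * L - 1 + 1) → Edge 3 L → Matrix (Fin 2) (Fin 2) ℂ) × (Site 3 L → Matrix (Fin 2) (Fin 2) ℂ) =>
            pauliCoord (centralDir L (s M) (s₄ M) M (Sum.inl (i, e))) a) = fun M => pauliCoord (quatMatrix ⟨0,
              anchoredIm (clampLift (s M e.2) (blockAvgM L e.2 M)) (M.1 i e) 0 + (1 / 2 : ℝ) * s M e.2 * blockAvgM L e.2 M 0,
              anchoredIm (clampLift (s M e.2) (blockAvgM L e.2 M)) (M.1 i e) 1 + (1 / 2 : ℝ) * s M e.2 * blockAvgM L e.2 M 1,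
              anchoredIm (clampLift (s M e.2) (blockAvgM L e.2 M)) (M.1 i e) 2 + (1 / 2 : ℝ) * s M e.2 * blockAvgM L e.2 M 2⟩) a := by
          funext M
          simp only [centralDir, h1, h2, if_false, if_true]
        rw [ef]
        exact contDiff_pauliCoord_quatMatrix_comp
          (contDiff_blockComponent (hs e.2) (fun b => contDiff_blockAvgM e.2 b) (contDiff_coord_fst i e) 0)
          (contDiff_blockComponent (hs e.2) (fun b => contDiff_blockAvgM e.2 b) (contDiff_coord_fst i e) 1)
          (contDiff_blockComponent (hs e.2) (fun b => contDiff_blockAvgM e.2 b) (contDiff_coord_fst i e) 2) a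
      · have ef : (fun M : (Fin (2 * L - 1 + 1) → Edge 3 L → Matrix (Fin 2) (Fin 2) ℂ) × (Site 3 L → Matrix (Fin 2) (Fin 2) ℂ) =>
            pauliCoord (centralDir L (s M) (s₄ M) M (Sum.inl (i, e))) a) = fun M => pauliCoord (quatMatrix ⟨0,
              anchoredIm 1 (M.1 i e) 0, anchoredIm 1 (M.1 i e) 1, anchoredIm 1 (M.1 i e) 2⟩) a := by
          funext M
          simp only [centralDir, h1, h2, if_false]
        rw [ef]
        have hone : ∀ b : Fin 3, ContDiff ℝ ∞ fun M : (Fin (2 * L - 1 + 1) → Edge 3 L → Matrix (Fin 2) (Fin 2) ℂ) × (Site 3 L → Matrix (Fin 2) (Fin 2) ℂ) =>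
            anchoredIm 1 (M.1 i e) b := fun b =>
          contDiff_anchoredIm_comp (c := fun _ => (1 : ℍ)) contDiff_const contDiff_const contDiff_const contDiff_const (contDiff_coord_fst i e) b
        exact contDiff_pauliCoord_quatMatrix_comp (hone 0) (hone 1) (hone 2) a
  · have ef : (fun M : (Fin (2 * L - 1 + 1) → Edge 3 L → Matrix (Fin 2) (Fin 2) ℂ) × (Site 3 L → Matrix (Fin 2) (Fin 2) ℂ) =>
        pauliCoord (centralDir L (s M) (s₄ M) M (Sum.inr x)) a) = fun M => pauliCoord (quatMatrix ⟨0,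
          anchoredIm (clampLift (s₄ M) (seamAvgM L M)) (M.2 x) 0 + (1 / 2 : ℝ) * s₄ M * seamAvgM L M 0,
          anchoredIm (clampLift (s₄ M) (seamAvgM L M)) (M.2 x) 1 + (1 / 2 : ℝ) * s₄ M * seamAvgM L M 1,
          anchoredIm (clampLift (s₄ M) (seamAvgM L M)) (M.2 x) 2 + (1 / 2 : ℝ) * s₄ M * seamAvgM L M 2⟩) a := by
      funext M
      simp only [centralDir]
    rw [ef]
    exact contDiff_pauliCoord_quatMatrix_comp
      (contDiff_blockComponent hs₄ (fun b => contDiff_seamAvgM b) (contDiff_coord_snd x) 0)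
      (contDiff_blockComponent hs₄ (fun b => contDiff_seamAvgM b) (contDiff_coord_snd x) 1)
      (contDiff_blockComponent hs₄ (fun b => contDiff_seamAvgM b) (contDiff_coord_snd x) 2) a

/-! ## §4 Smoothness of the central coefficient family -/

/-- ★★★ **The central coefficients are smooth, for smooth sign functions** `s_k`, `s₄`: `M ↦ centralCoeff L (s M) (s₄ M) va M` is `C^∞`. [cite: CosteEtAl1985] -/
theorem contDiff_centralCoeff_param
    {s : ((Fin (2 * L - 1 + 1) → Edge 3 L → Matrix (Fin 2) (Fin 2) ℂ) × (Site 3 L → Matrix (Fin 2) (Fin 2) ℂ)) → Fin 3 → ℝ}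
    {s₄ : ((Fin (2 * L - 1 + 1) → Edge 3 L → Matrix (Fin 2) (Fin 2) ℂ) × (Site 3 L → Matrix (Fin 2) (Fin 2) ℂ)) → ℝ}
    (hs : ∀ k, ContDiff ℝ ∞ fun M => s M k) (hs₄ : ContDiff ℝ ∞ s₄) (va : FixVar L × Fin 3) :
    ContDiff ℝ ∞ fun M : (Fin (2 * L - 1 + 1) → Edge 3 L → Matrix (Fin 2) (Fin 2) ℂ) × (Site 3 L → Matrix (Fin 2) (Fin 2) ℂ) =>
      centralCoeff L (s M) (s₄ M) va M := by
  unfold centralCoeff fixCoord stdCoord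
  exact contDiff_centralDir_pauliCoord hs hs₄ (fixVar va.1) va.2

/-- ★★★ **The central coefficients with constant signs are smooth** — hypothesis `hc` of ✓`periodicSoftness_of_smoothFrameField_cutoff` ∕ `h₂` of
✓`FieldPatching.patch_div_le_signed` for the central piece. [cite: CosteEtAl1985] -/
theorem contDiff_centralCoeff (σ : Fin 3 → ℝ) (σ₄ : ℝ) (va : FixVar L × Fin 3) : ContDiff ℝ ∞ (centralCoeff L σ σ₄ va) :=
  contDiff_centralCoeff_param (s := fun _ => σ) (s₄ := fun _ => σ₄) (fun _ => contDiff_const) contDiff_const va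

/-- ★★★ **ONE global smooth central family**: with the smooth sign selectors `σ_k := linkSign k M`, `σ₄ := seamSign M` (✓`CentralSignSelector`; equal to
the toron signs and locally constant on the central region) the coefficients `M ↦ centralCoeff L (linkSign · M) (seamSign M) va M` are `C^∞`. [cite: CosteEtAl1985] -/
theorem contDiff_centralCoeff_sign (va : FixVar L × Fin 3) :
    ContDiff ℝ ∞ fun M : (Fin (2 * L - 1 + 1) → Edge 3 L → Matrix (Fin 2) (Fin 2) ℂ) × (Site 3 L → Matrix (Fin 2) (Fin 2) ℂ) =>
      centralCoeff L (fun k => linkSign k M) (seamSign M) va M :=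
  contDiff_centralCoeff_param (s := fun M k => linkSign k M) (s₄ := seamSign) (fun k => contDiff_linkSign k) contDiff_seamSign va

end Summit.QuantumFields.YangMills.Theorems.VirialFluxGap.CentralField

end
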